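import Summits.KontsevichZagierPeriods.KontsevichZagierPeriods.Theorems.HermiteRigidityIslandComplementBoxFiveTerm
import Summits.KontsevichZagierPeriods.KontsevichZagierPeriods.Theorems.HermiteRigidityReductionRigidityEulerDeformation
import Summits.KontsevichZagierPeriods.KontsevichZagierPeriods.Theorems.HermiteRigidityReductionRigidityNeumannAlgebra
import Summits.KontsevichZagierPeriods.KontsevichZagierPeriods.Theorems.HermiteRigidityReductionRigidityLandenRat
import Summits.KontsevichZagierPeriods.KontsevichZagierPeriods.Theorems.MzvKernelInKZ.Negative.ScalingDivision
import Literature.NumberTheory.Transcendental.BlochGroupRatTorsion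

/-!
# `ReductionRigidity` (stmt-KontsevichZagierPeriods-3407), line `Sketch`, growth line
# `bloch-suslin-rational-dilog`: the REAL five-term transfer, II — the move chains (`stub_neumannTransfer`)

Route `KontsevichZagierPeriods/HermiteRigidity`, crux `ReductionRigidity` (stmt-3407, summit-equivalent; skeleton
`Cruxes/ReductionRigidity/Lines/Sketch.lean` v7). Registered LEAD stub `stub_neumannTransfer` (seat c6): the realisation
`B(z) = [□², z/(1−zpq)]` (`z < 1`), `−B(1/z)` (`z > 1`) of the generators of Neumann's presentation `PreBloch ℚ`
(Literature `PreBlochGroup.lean`) kills the subgroup generated by ALL RATIONAL FIVE-TERM RELATORS modulo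
`KZ.relations ⊔ W`, `W = ⟨[□², e/((α+βp)(γ+δq))] (products of two logarithmic slabs), [□², e/(1+pq)] (the ζ(2)-line)⟩`.
Part I (`…NeumannAlgebra.lean`) is the cyclic-order case analysis for an abstract symbol; this part FEEDS ITS THREE
HYPOTHESES FROM LANDED MOVE CHAINS: Abel's five-term identity (`stub_boxFiveTerm`; its `log·log` term is a carrier —
`abel_instance`), Landen pairs (`stub_landenRat` at every rational point; the doubled relation is halved by the
torsion-freeness of `FormalRep ⧸ relations` and integrand additivity — `landen_pair`), Euler pairs (`stub_eulerDeformation`: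
`E(x) ≡ E(1/2)`; the anchor `E(1/2) = 2[1/2] + carrier` lies in `relations ⊔ W` because the Landen pair at `1/2` is
`[1/2] + [−1]` and `[−1] = [□², −1/(1+pq)]` is a carrier — `euler_pair`). Consequences over Suslin's theorem
(`DehnClosedReduces`, the rational dilogarithm island): `…DehnClosedReduces.lean`.

References: W. D. Neumann, Geom. Topol. Monogr. 1 (1998), eq. (2.3) [cite: Neumann1998, eq. (2.3)]; D. Zagier, *The
dilogarithm function* (2007), Ch. I §2 [cite: Zagier2007Dilogarithm, Ch. I §2]; M. Kontsevich, D. Zagier, *Periods* (2001),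
§1.2 [cite: KontsevichZagier2001, §1.2]; A. A. Suslin (1991), Thm. 5.2 [cite: Suslin1991, Thm. 5.2]. No definitions are
introduced.
-/

noncomputable section

open MeasureTheory Set MvPolynomial

namespace Summit.KontsevichZagierPeriods.HermiteRigidity.ReductionRigidity

open Literature.NumberTheory.Transcendental
open Literature.NumberTheory.Transcendental.KZ

/-! ## Carrier representations -/

/-- An affine function positive at both endpoints is positive on `[0,1]`. [folklore] -/
theorem affine_pos_of_endpoints {α β : ℚ} (hα : 0 < α) (hαβ : 0 < α + β) {t : ℝ} (ht : 0 ≤ t ∧ t ≤ 1) :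
    0 < (α : ℝ) + β * t := by
  have hα' : (0 : ℝ) < α := by exact_mod_cast hα
  have hαβ' : (0 : ℝ) < α + β := by exact_mod_cast hαβ
  have hsplit : (α : ℝ) + β * t = (1 - t) * α + t * (α + β) := by ring
  rw [hsplit]
  rcases le_or_gt t (1 / 2) with h | h
  · nlinarith [mul_nonneg ht.1 hαβ'.le]
  · nlinarith [mul_nonneg (sub_nonneg.2 ht.2) hα'.le]

/-- The product-of-two-logarithmic-slabs carrier `[□², e/((α + βp₀)(γ + δp₁))]` exists as a regular
rational representation on the closed square. [cite: KontsevichZagier2001, §1.1] -/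
theorem exists_carrierRep (e α β γ δ : ℚ) (hα : 0 < α) (hαβ : 0 < α + β) (hγ : 0 < γ)
    (hγδ : 0 < γ + δ) : ∃ r : IntegralRep 2, r.domain = cube 2 ∧
      EqOn r.integrand (fun p => (e : ℝ) / (((α : ℝ) + β * p 0) * ((γ : ℝ) + δ * p 1))) (cube 2) := by
  have hden : ∀ x ∈ cube 2,
      aeval x ((C α + C β * X 0) * (C γ + C δ * X 1) : MvPolynomial (Fin 2) ℚ) ≠ 0 := by
    intro x hx
    simp only [map_add, map_mul, aeval_C, aeval_X, eq_ratCast]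
    exact mul_ne_zero (affine_pos_of_endpoints hα hαβ (hx 0)).ne'
      (affine_pos_of_endpoints hγ hγδ (hx 1)).ne'
  refine ⟨(⟨C e, _, hden⟩ : RFun 2).rep, rfl, fun x _ => ?_⟩
  simp [RFun.rep_integrand, RFun.fn]

/-! ## The landed KZ move chains (`stub_landenRat`, `stub_eulerDeformation`, `stub_boxFiveTerm`) as two- and five-term
relations modulo the carrier subgroup -/

section Inputs

variable {W : AddSubgroup FormalRep} (ρ : ℚ → IntegralRep 2)

/-- **Landen pairs modulo carriers**: from Landen's identity at rational points
(`2[x] + 2[x/(x−1)] + [log²(1−x)] ∈ relations`), torsion-freeness of `FormalRep ⧸ relations` and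
halving of the carrier, `[□², u/(1−upq)] + [□², u'/(1−u'pq)] ∈ relations ⊔ W` for `u'(u − 1) = u`.
[cite: Zagier2007Dilogarithm, Ch. I §2] [cite: KontsevichZagier2001, §1.2] -/
theorem landen_pair
    (hW : ∀ (r : IntegralRep 2) (e α β γ δ : ℚ), 0 < α → 0 < α + β → 0 < γ → 0 < γ + δ →
      r.domain = cube 2 →
      EqOn r.integrand (fun p => (e : ℝ) / (((α : ℝ) + β * p 0) * ((γ : ℝ) + δ * p 1))) (cube 2) →
      KZ.of r ∈ W)
    (hρ : ∀ z : ℚ, z < 1 → z ≠ 0 → (ρ z).domain = cube 2 ∧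
      EqOn (ρ z).integrand (fun p => (z : ℝ) / (1 - (z : ℝ) * p 0 * p 1)) (cube 2))
    (u u' : ℚ) (hu : 0 < u) (hu1 : u < 1) (hu' : u' * (u - 1) = u) :
    KZ.of (ρ u) + KZ.of (ρ u') ∈ KZ.relations ⊔ W := by
  obtain rfl : u' = u / (u - 1) := (eq_div_iff (by linarith)).2 hu'
  have hu0 : u ≠ 0 := hu.ne'
  have hneg : u / (u - 1) < 0 := div_neg_of_pos_of_neg hu (by linarith)
  -- the carrier `log²(1 − u)` and its half
  obtain ⟨r₃, hr₃, hr₃i⟩ := exists_carrierRep (u ^ 2) 1 (-u) 1 (-u) one_pos (by linarith) one_pos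
    (by linarith)
  obtain ⟨h, hh, hhi⟩ := exists_carrierRep (u ^ 2 / 2) 1 (-u) 1 (-u) one_pos (by linarith) one_pos
    (by linarith)
  have hL := stub_landenRat u hu hu1 (ρ u) (ρ (u / (u - 1))) r₃ (hρ u hu1 hu0).1 (hρ u hu1 hu0).2
    (hρ _ (hneg.trans zero_lt_one) hneg.ne).1 (hρ _ (hneg.trans zero_lt_one) hneg.ne).2 hr₃
    (fun p hp => by rw [hr₃i hp]; push_cast; ring)
  have hsplit : KZ.of r₃ - KZ.of h - KZ.of h ∈ KZ.relations :=
    integrandAddRel_subset_relations ⟨2, r₃, h, h, hh.trans hr₃.symm, hh.trans hr₃.symm,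
      fun p hp => by
        rw [hr₃] at hp
        rw [Pi.add_apply, hr₃i hp, hhi hp]; push_cast; ring, rfl⟩
  have h2 : 2 • (KZ.of (ρ u) + KZ.of (ρ (u / (u - 1))) + KZ.of h) ∈ KZ.relations := by
    have : 2 • (KZ.of (ρ u) + KZ.of (ρ (u / (u - 1))) + KZ.of h) =
        (2 • KZ.of (ρ u) + 2 • KZ.of (ρ (u / (u - 1))) + KZ.of r₃) - (KZ.of r₃ - KZ.of h - KZ.of h) := by
      abel
    rw [this]
    exact KZ.relations.sub_mem hL hsplit
  have h1 := Summit.KontsevichZagierPeriods.MzvKernelInKZ.Negative.mem_relations_of_nsmul_mem two_pos h2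
  have hhW : KZ.of h ∈ W := hW h (u ^ 2 / 2) 1 (-u) 1 (-u) one_pos (by linarith) one_pos (by linarith) hh hhi
  have : KZ.of (ρ u) + KZ.of (ρ (u / (u - 1))) =
      (KZ.of (ρ u) + KZ.of (ρ (u / (u - 1))) + KZ.of h) - KZ.of h := by abel
  rw [this]
  exact (KZ.relations ⊔ W).sub_mem (AddSubgroup.mem_sup_left h1) (AddSubgroup.mem_sup_right hhW)

/-- **Euler pairs modulo carriers**: from the deformation invariance of Euler's combination
`E(x) = [x] + [1−x] + [log x·log(1−x)]`, the anchor `E(1/2) = 2[1/2] + carrier`, the Landen pair at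
`1/2` (`[1/2] + [−1]`) and `[−1] = −[□², 1/(1+pq)] ∈ W`:
`[□², t/(1−tpq)] + [□², (1−t)/(1−(1−t)pq)] ∈ relations ⊔ W`.
[cite: Zagier2007Dilogarithm, Ch. I §2] [cite: KontsevichZagier2001, §1.2] -/
theorem euler_pair
    (hW : ∀ (r : IntegralRep 2) (e α β γ δ : ℚ), 0 < α → 0 < α + β → 0 < γ → 0 < γ + δ →
      r.domain = cube 2 →
      EqOn r.integrand (fun p => (e : ℝ) / (((α : ℝ) + β * p 0) * ((γ : ℝ) + δ * p 1))) (cube 2) →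
      KZ.of r ∈ W)
    (hW₂ : ∀ (r : IntegralRep 2) (e : ℚ), r.domain = cube 2 →
      EqOn r.integrand (fun p => (e : ℝ) / (1 + p 0 * p 1)) (cube 2) → KZ.of r ∈ W)
    (hρ : ∀ z : ℚ, z < 1 → z ≠ 0 → (ρ z).domain = cube 2 ∧
      EqOn (ρ z).integrand (fun p => (z : ℝ) / (1 - (z : ℝ) * p 0 * p 1)) (cube 2))
    (t t' : ℚ) (ht : 0 < t) (ht1 : t < 1) (ht' : t' = 1 - t) :
    KZ.of (ρ t) + KZ.of (ρ t') ∈ KZ.relations ⊔ W := by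
  subst ht'
  -- the log·log carriers at `t` and at `1/2`
  have hLL : ∀ s : ℚ, 0 < s → s < 1 → ∃ r : IntegralRep 2, r.domain = cube 2 ∧
      EqOn r.integrand (fun p => (((s : ℝ) - 1) / (1 + ((s : ℝ) - 1) * p 0)) *
        ((-(s : ℝ)) / (1 - (s : ℝ) * p 1))) (cube 2) ∧ KZ.of r ∈ W := by
    intro s hs hs1
    obtain ⟨r, hr, hri⟩ := exists_carrierRep ((s - 1) * (-s)) 1 (s - 1) 1 (-s) one_pos (by linarith)
      one_pos (by linarith)
    refine ⟨r, hr, fun p hp => ?_, hW r _ 1 (s - 1) 1 (-s) one_pos (by linarith) one_pos (by linarith)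
      hr hri⟩
    have h1 : (0 : ℝ) < 1 + ((s : ℝ) - 1) * p 0 := by
      have := affine_pos_of_endpoints (α := 1) (β := s - 1) one_pos (by linarith) (hp 0)
      push_cast at this; linarith
    have h2 : (0 : ℝ) < 1 - (s : ℝ) * p 1 := by
      have := affine_pos_of_endpoints (α := 1) (β := -s) one_pos (by linarith) (hp 1)
      push_cast at this; linarith
    rw [hri hp]
    beta_reduce
    rw [div_mul_div_comm]
    push_cast
    ring
  obtain ⟨L, hL, hLi, hLW⟩ := hLL t ht ht1
  obtain ⟨Lh, hLh, hLhi, hLhW⟩ := hLL (1 / 2) (by norm_num) (by norm_num)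
  have hρ' : ∀ z : ℚ, 0 < z → z < 1 → (ρ z).domain = cube 2 ∧
      EqOn (ρ z).integrand (fun p => (z : ℝ) / (1 - (z : ℝ) * p 0 * p 1)) (cube 2) :=
    fun z hz hz1 => hρ z hz1 hz.ne'
  -- deformation from `t` to `1/2`
  have hdef := stub_eulerDeformation t (1 / 2) ht ht1 (by norm_num) (by norm_num) (ρ t) (ρ (1 - t)) L (ρ (1 / 2))
    (ρ (1 - 1 / 2)) Lh (hρ' t ht ht1).1 (hρ' t ht ht1).2 (hρ' _ (by linarith) (by linarith)).1
    (hρ' _ (by linarith) (by linarith)).2 hL hLi (hρ' _ (by norm_num) (by norm_num)).1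
    (hρ' _ (by norm_num) (by norm_num)).2 (hρ' _ (by norm_num) (by norm_num)).1
    (hρ' _ (by norm_num) (by norm_num)).2 hLh hLhi
  -- the anchor: `[1/2] ∈ relations ⊔ W` by the Landen pair at `1/2` and `[−1] ∈ W`
  have hhalf : KZ.of (ρ (1 / 2)) ∈ KZ.relations ⊔ W := by
    have hLp := landen_pair ρ hW hρ (1 / 2) (-1) (by norm_num) (by norm_num) (by norm_num)
    have hm1 : KZ.of (ρ (-1)) ∈ W := by
      refine hW₂ (ρ (-1)) (-1) (hρ (-1) (by norm_num) (by norm_num)).1 fun p hp => ?_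
      rw [(hρ (-1) (by norm_num) (by norm_num)).2 hp]
      push_cast
      ring
    have : KZ.of (ρ (1 / 2)) = (KZ.of (ρ (1 / 2)) + KZ.of (ρ (-1))) - KZ.of (ρ (-1)) := by abel
    rw [this]
    exact (KZ.relations ⊔ W).sub_mem hLp (AddSubgroup.mem_sup_right hm1)
  have h12 : (1 : ℚ) - 1 / 2 = 1 / 2 := by norm_num
  rw [h12] at hdef
  have : KZ.of (ρ t) + KZ.of (ρ (1 - t)) =
      ((KZ.of (ρ t) + KZ.of (ρ (1 - t)) + KZ.of L) - (KZ.of (ρ (1 / 2)) + KZ.of (ρ (1 / 2)) + KZ.of Lh)) +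
        (KZ.of (ρ (1 / 2)) + KZ.of (ρ (1 / 2)) + KZ.of Lh) - KZ.of L := by abel
  rw [this]
  refine (KZ.relations ⊔ W).sub_mem ((KZ.relations ⊔ W).add_mem (AddSubgroup.mem_sup_left hdef)
    ((KZ.relations ⊔ W).add_mem ((KZ.relations ⊔ W).add_mem hhalf hhalf)
      (AddSubgroup.mem_sup_right hLhW))) (AddSubgroup.mem_sup_right hLW)

/-- **Abel instances modulo carriers**, from the landed `stub_boxFiveTerm`: for rational
`0 < a, b < 1` and `c = ab`, `d(1 − ab) = a(1 − b)`, `e(1 − ab) = b(1 − a)`,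
`[a] + [b] − [c] − [d] − [e] ∈ relations ⊔ W` (the `log·log` term is a carrier).
[cite: Zagier2007Dilogarithm, Ch. I §2] -/
theorem abel_instance
    (hW : ∀ (r : IntegralRep 2) (e α β γ δ : ℚ), 0 < α → 0 < α + β → 0 < γ → 0 < γ + δ →
      r.domain = cube 2 →
      EqOn r.integrand (fun p => (e : ℝ) / (((α : ℝ) + β * p 0) * ((γ : ℝ) + δ * p 1))) (cube 2) →
      KZ.of r ∈ W)
    (hρ : ∀ z : ℚ, z < 1 → z ≠ 0 → (ρ z).domain = cube 2 ∧
      EqOn (ρ z).integrand (fun p => (z : ℝ) / (1 - (z : ℝ) * p 0 * p 1)) (cube 2))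
    (a b c d e : ℚ) (ha : 0 < a) (ha1 : a < 1) (hb : 0 < b) (hb1 : b < 1) (hc : c = a * b)
    (hd : d * (1 - a * b) = a * (1 - b)) (he : e * (1 - a * b) = b * (1 - a)) :
    KZ.of (ρ a) + KZ.of (ρ b) - KZ.of (ρ c) - KZ.of (ρ d) - KZ.of (ρ e) ∈ KZ.relations ⊔ W := by
  subst hc
  have hab : a * b < 1 := by nlinarith
  have hab0 : 0 < 1 - a * b := by linarith
  have hd' : d = a * (1 - b) / (1 - a * b) := (eq_div_iff hab0.ne').2 hd
  have he' : e = b * (1 - a) / (1 - a * b) := (eq_div_iff hab0.ne').2 he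
  have hc01 : 0 < a * b ∧ a * b < 1 := ⟨mul_pos ha hb, hab⟩
  have hd01 : 0 < d ∧ d < 1 := by
    rw [hd']; exact neumann_div_mem (mul_pos ha (by linarith)) (by nlinarith)
  have he01 : 0 < e ∧ e < 1 := by
    rw [he']; exact neumann_div_mem (mul_pos hb (by linarith)) (by nlinarith)
  -- the `log·log` carrier of Abel's identity
  obtain ⟨r₆, hr₆, hr₆i⟩ := exists_carrierRep (a * (1 - b) * (b * (1 - a))) (1 - a * b) (-(a * (1 - b)))
    (1 - a * b) (-(b * (1 - a))) hab0 (by nlinarith) hab0 (by nlinarith)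
  have hr₆W := hW r₆ _ _ _ _ _ hab0 (by nlinarith) hab0 (by nlinarith) hr₆ hr₆i
  have hρa := hρ a ha1 ha.ne'
  have hρb := hρ b hb1 hb.ne'
  have hρc := hρ (a * b) hc01.2 hc01.1.ne'
  have hρd := hρ d hd01.2 hd01.1.ne'
  have hρe := hρ e he01.2 he01.1.ne'
  -- real-number forms of the hypotheses
  have hdR : (d : ℝ) * (1 - a * b) = a * (1 - b) := by exact_mod_cast hd
  have heR : (e : ℝ) * (1 - a * b) = b * (1 - a) := by exact_mod_cast he
  have habR : (0 : ℝ) < 1 - a * b := by exact_mod_cast hab0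
  have h5 := stub_boxFiveTerm a b ha ha1 hb hb1 (ρ a) (ρ b) (ρ (a * b)) (ρ d) (ρ e) r₆ hρa.1 hρa.2 hρb.1
    hρb.2 hρc.1 (fun p hp => by rw [hρc.2 hp]; push_cast; ring) hρd.1 (fun p hp => by
      have hb' := landen_face_bounds hp
      have hD : (0 : ℝ) < 1 - (a : ℝ) * b - (a : ℝ) * (1 - b) * p 0 * p 1 := by
        have : (a : ℝ) * (1 - b) * (p 0 * p 1) ≤ a * (1 - b) := by
          have h1 : (0 : ℝ) < a * (1 - b) := by exact_mod_cast mul_pos ha (by linarith : 0 < 1 - b)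
          nlinarith [hb'.2.2.2.2.2]
        have ha1' : (a : ℝ) < 1 := by exact_mod_cast ha1
        nlinarith
      have hDd : (0 : ℝ) < 1 - (d : ℝ) * p 0 * p 1 := by
        have : (d : ℝ) * (p 0 * p 1) ≤ d := by
          have h1 : (0 : ℝ) < d := by exact_mod_cast hd01.1
          nlinarith [hb'.2.2.2.2.2]
        have hd1' : (d : ℝ) < 1 := by exact_mod_cast hd01.2
        nlinarith
      rw [hρd.2 hp, div_eq_div_iff hDd.ne' hD.ne']
      linear_combination hdR) hρe.1 (fun p hp => by
      have hb' := landen_face_bounds hp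
      have hD : (0 : ℝ) < 1 - (a : ℝ) * b - (b : ℝ) * (1 - a) * p 0 * p 1 := by
        have : (b : ℝ) * (1 - a) * (p 0 * p 1) ≤ b * (1 - a) := by
          have h1 : (0 : ℝ) < b * (1 - a) := by exact_mod_cast mul_pos hb (by linarith : 0 < 1 - a)
          nlinarith [hb'.2.2.2.2.2]
        have hb1' : (b : ℝ) < 1 := by exact_mod_cast hb1
        nlinarith
      have hDe : (0 : ℝ) < 1 - (e : ℝ) * p 0 * p 1 := by
        have : (e : ℝ) * (p 0 * p 1) ≤ e := by
          have h1 : (0 : ℝ) < e := by exact_mod_cast he01.1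
          nlinarith [hb'.2.2.2.2.2]
        have he1' : (e : ℝ) < 1 := by exact_mod_cast he01.2
        nlinarith
      rw [hρe.2 hp, div_eq_div_iff hDe.ne' hD.ne']
      linear_combination heR) hr₆ (fun p hp => by
      rw [hr₆i hp]
      beta_reduce
      rw [div_mul_div_comm]
      push_cast
      ring)
  have : KZ.of (ρ a) + KZ.of (ρ b) - KZ.of (ρ (a * b)) - KZ.of (ρ d) - KZ.of (ρ e) =
      (KZ.of (ρ a) + KZ.of (ρ b) - KZ.of (ρ (a * b)) - KZ.of (ρ d) - KZ.of (ρ e) - KZ.of r₆) +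
        KZ.of r₆ := by
    abel
  rw [this]
  exact (KZ.relations ⊔ W).add_mem (AddSubgroup.mem_sup_left h5) (AddSubgroup.mem_sup_right hr₆W)

end Inputs

/-! ## The transfer -/

/-- Unfolding the lift of `B` on a Neumann relator. [cite: Neumann1998, eq. (2.3)] -/
theorem lift_fiveTermRelator (B : PreBloch.Gen ℚ → FormalRep) (x y : PreBloch.Gen ℚ) (hxy : x.val ≠ y.val) :
    FreeAbelianGroup.lift B (fiveTermRelator ℚ x y hxy) =
      B x - B y + B (PreBloch.Gen.quot x y hxy) - B (PreBloch.Gen.quotInv x y hxy) +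
        B (PreBloch.Gen.quotSub x y hxy) := by
  simp only [fiveTermRelator, map_add, map_sub, FreeAbelianGroup.lift_apply_of]

/-- **Registered LEAD stub `stub_neumannTransfer` — THE REAL FIVE-TERM TRANSFER AT RATIONAL ARGUMENTS**
(crux `ReductionRigidity`, stmt-3407, line `Sketch`, growth line `bloch-suslin-rational-dilog`): for ANY family `ρ` of
representations of the rational dilogarithm symbols `[□², z/(1 − z p₀p₁)]` (`z < 1`), the real-period realisation
`B(z) = [ρ z]` (`z < 1`), `B(z) = −[ρ z⁻¹]` (`z > 1`) of Neumann's generators sends the subgroup generated by ALL rational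
five-term relators `[x] − [y] + [y/x] − [(1−x⁻¹)/(1−y⁻¹)] + [(1−x)/(1−y)]` into
`KZ.relations ⊔ ⟨[□², e/((α+βp)(γ+δq))], [□², e/(1+pq)]⟩` — modulo products of two logarithms and the `ζ(2)`-line
every rational Neumann relator is a chain of moves of the Kontsevich–Zagier calculus; the real (Rogers) counterpart of
HyperbolicBloch's Bloch–Wigner `FiveTermTransfer`, which kills real points by construction. Proof: the cyclic-order
algebra `stub_neumannAlgebra` fed with `abel_instance`, `euler_pair`, `landen_pair`.
[cite: Neumann1998, eq. (2.3)] [cite: Zagier2007Dilogarithm, Ch. I §2] [cite: KontsevichZagier2001, §1.2] -/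
theorem stub_neumannTransfer : ∀ (ρ : ℚ → IntegralRep 2),
    (∀ z : ℚ, z < 1 → z ≠ 0 → (ρ z).domain = cube 2 ∧
      EqOn (ρ z).integrand (fun p => (z : ℝ) / (1 - (z : ℝ) * p 0 * p 1)) (cube 2)) →
    ∀ ξ ∈ AddSubgroup.closure (fiveTermRelators ℚ),
      FreeAbelianGroup.lift (fun g : PreBloch.Gen ℚ =>
          if g.val < 1 then KZ.of (ρ g.val) else -KZ.of (ρ g.val⁻¹)) ξ ∈
        KZ.relations ⊔ AddSubgroup.closure
          ({c | ∃ (r : IntegralRep 2) (e α β γ δ : ℚ), 0 < α ∧ 0 < α + β ∧ 0 < γ ∧ 0 < γ + δ ∧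
              r.domain = cube 2 ∧
              EqOn r.integrand (fun p => (e : ℝ) / (((α : ℝ) + β * p 0) * ((γ : ℝ) + δ * p 1))) (cube 2) ∧
              c = KZ.of r} ∪
            {c | ∃ (r : IntegralRep 2) (e : ℚ), r.domain = cube 2 ∧
              EqOn r.integrand (fun p => (e : ℝ) / (1 + p 0 * p 1)) (cube 2) ∧ c = KZ.of r}) := by
  intro ρ hρ ξ hξ
  -- the carrier subgroup and its two generator families
  set W := AddSubgroup.closure
    ({c | ∃ (r : IntegralRep 2) (e α β γ δ : ℚ), 0 < α ∧ 0 < α + β ∧ 0 < γ ∧ 0 < γ + δ ∧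
        r.domain = cube 2 ∧
        EqOn r.integrand (fun p => (e : ℝ) / (((α : ℝ) + β * p 0) * ((γ : ℝ) + δ * p 1))) (cube 2) ∧
        c = KZ.of r} ∪
      {c | ∃ (r : IntegralRep 2) (e : ℚ), r.domain = cube 2 ∧
        EqOn r.integrand (fun p => (e : ℝ) / (1 + p 0 * p 1)) (cube 2) ∧ c = KZ.of r}) with hWdef
  have hW : ∀ (r : IntegralRep 2) (e α β γ δ : ℚ), 0 < α → 0 < α + β → 0 < γ → 0 < γ + δ →
      r.domain = cube 2 →
      EqOn r.integrand (fun p => (e : ℝ) / (((α : ℝ) + β * p 0) * ((γ : ℝ) + δ * p 1))) (cube 2) →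
      KZ.of r ∈ W := fun r e α β γ δ h1 h2 h3 h4 hr hri =>
    AddSubgroup.subset_closure (Or.inl ⟨r, e, α, β, γ, δ, h1, h2, h3, h4, hr, hri, rfl⟩)
  have hW₂ : ∀ (r : IntegralRep 2) (e : ℚ), r.domain = cube 2 →
      EqOn r.integrand (fun p => (e : ℝ) / (1 + p 0 * p 1)) (cube 2) → KZ.of r ∈ W := fun r e hr hri =>
    AddSubgroup.subset_closure (Or.inr ⟨r, e, hr, hri, rfl⟩)
  -- the lift kills every relator: the cyclic-order algebra fed with the three move chains
  have key : AddSubgroup.closure (fiveTermRelators ℚ) ≤ (KZ.relations ⊔ W).comap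
      (FreeAbelianGroup.lift (fun g : PreBloch.Gen ℚ =>
        if g.val < 1 then KZ.of (ρ g.val) else -KZ.of (ρ g.val⁻¹))) := by
    refine (AddSubgroup.closure_le _).2 fun c hc => ?_
    obtain ⟨x, y, hxy, rfl⟩ := hc
    rw [SetLike.mem_coe, AddSubgroup.mem_comap, lift_fiveTermRelator]
    simp only [PreBloch.Gen.val_quot, PreBloch.Gen.val_quotInv, PreBloch.Gen.val_quotSub]
    exact stub_neumannAlgebra FormalRep (KZ.relations ⊔ W) (fun z => KZ.of (ρ z))
      (fun z => if z < 1 then KZ.of (ρ z) else -KZ.of (ρ z⁻¹)) (fun z hz => if_pos hz)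
      (fun z hz => if_neg (not_lt.2 hz.le)) (abel_instance ρ hW hρ)
      (euler_pair ρ hW hW₂ hρ) (landen_pair ρ hW hρ) x.val y.val
      x.val_ne_zero x.val_ne_one y.val_ne_zero y.val_ne_one hxy
  exact key hξ

end Summit.KontsevichZagierPeriods.HermiteRigidity.ReductionRigidity

end
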